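import Summits.BirchSwinnertonDyer.Rank1Residual.X2.GreenbergVatsalReductionDatum
import Summits.BirchSwinnertonDyer.Rank1Residual.X2.GreenbergVatsalTateDatumCofree
import HarnessLib

/-!
# `#(C_p ∩ E[p^∞][p]) = p` for GREENBERG'S REDUCTION DATUM at a good ORDINARY prime of `E/ℚ`
# (cell `b2b-bsdres`, unit `b2b-bsdres-eisenstein-p2`, gen 19; X2-GAP §21.6 (iii): the brick that lets
# the gen-16 residual devissage — GV display (16) — run VERBATIM at a good ordinary Eisenstein prime)

HONEST FRAMING (run/shared/lean/b2b/bsd-rank1-residual/, verbatim in every file): the goal of the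
cell is to DELETE the COMBINATION-SHAPED residual classes of the Birch–Swinnerton-Dyer formula for
ALL analytic-rank `≤ 1` elliptic curves over `ℚ` — "full BSD formula for every rank `≤ 1` curve in
class `C`" assembled STRICTLY from published theorems — so that the rank-`≤ 1` remainder becomes
exactly the CONSTRUCTION-SHAPED classes, which are TYPED (missing-input `Prop`s), NOT attempted.
This is not "finishing BSD". Research route; NO CLAIM BEYOND STATED CLASSES; nothing here changes
a label. Theorems only: no definition, no named fact.

WHAT. Gen 9 built Greenberg's datum `C_v = ker(E[p^∞] → Ẽ(k̄_v))` at a good prime `v ∋ p`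
(`GreenbergVatsalReductionDatum.reductionDatum`) and discharged "`I_p` trivial on `D`" and the Kummer
compatibility; gen 9/`…ReductionDatumLine` discharged `hgen`. The one structural input of the gen-16
devissage (`ResidualDevissageLine.natCard_gvSelmer_torsion_eq_mul_of_line`, hypothesis `hcard`) and of
gen 13's counts (`exists_data_count_of_*`, clause `#(C ∩ E[p^∞][p]) = p`) that was proved only for the
TATE datum (`GreenbergVatsalTateDatumCofree.natCard_tateDatum_plus_inf_torsionBy`) is proved here for
the reduction datum: at a good ORDINARY `p` (`p ∤ a_p`), `C_v[p]` is cyclic of order `p` — Greenberg's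
"`ℱ[p^∞] ≅ ℚ_p/ℤ_p`" (LNM 1716 §1 p. 62, §2 p. 70), Greenberg–Vatsal's "`d⁺ = 1`" (p. 14) — from the
tree's ordinary filtration on `E(K̄_v)` (`OrdinaryLocalReductionMapProofs.localRed_ordinary_filtration`:
`(ker red_v)[p^r]` is generated by one point of order `p^r`) and the algebraicity of torsion
(`GreenbergVatsalTateDatumCofree.exists_primaryTorsion_pointsMap_eq`).

* `natCard_reductionDatum_plus_inf_torsionBy` — `Nat.card (C_v ⊓ E[p^∞][p]) = p`;
* `natCard_reductionData_plus_inf_torsionBy` — the same for the data `reductionData W p hΔ` (the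
  shape of the clause `hC`/`hcard` consumed by gens 13/16).

References: Greenberg, LNM 1716 (1999) §1 p. 62, §2 p. 70; Greenberg–Vatsal 2000 §2 p. 14;
Silverman *AEC* VII.2.1, III.6.4; HOME/b2b-bsdres-eisenstein-p2/X2-GAP.md §21.6 (iii), §24.
-/

noncomputable section

open scoped Classical AddSubgroup NNReal

open NumberField IsDedekindDomain Field
open Literature.NumberTheory.EllipticCurves Literature.NumberTheory.EllipticCurves.GreenbergSelmer
  Literature.NumberTheory.GaloisRepresentations IsDedekindDomain.HeightOneSpectrum
  Summit.BirchSwinnertonDyer.Rank1Residual.X2.GreenbergVatsalTorsion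
open WeierstrassCurve (minimalDiscriminantInt integralModelInt)

universe u

namespace Summit.BirchSwinnertonDyer.Rank1Residual.X2.GreenbergVatsalReductionDatum

variable (W : WeierstrassCurve ℚ) [W.IsGloballyMinimal] [W.IsElliptic] (p : ℕ) [hp : Fact p.Prime]
  {v : HeightOneSpectrum (𝓞 ℚ)}

/-- **`#(C_v ∩ E[p^∞][p]) = p` at a good ORDINARY prime** (`p ∤ Δ_E`, `p ∤ a_p`): the `p`-torsion
of Greenberg's datum `C_v = ker(E[p^∞] → Ẽ(k̄_v))` has exactly `p` elements. Proof: the ordinary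
filtration (`localRed_ordinary_filtration`, from the ordinary point `exists_zsmul_eq_zero_localRed_ne_zero`)
gives a point `P₁ ∈ ker red_v` of order `p` such that every `P ∈ ker red_v` with `pP = 0` is a
multiple of `P₁`; `P₁ = ι m₁` for some `m₁ ∈ E[p^∞](ℚ̄)` (torsion is algebraic), and `c ↦ c·m₁`,
`ℤ/p → C_v ⊓ E[p^∞][p]`, is a bijection (`ι` injective). This is Greenberg's `ℱ[p^∞] ≅ ℚ_p/ℤ_p` at the
level `p` / Greenberg–Vatsal's "`d⁺ = 1`" for the good-ordinary datum.
[cite: GreenbergLNM1716, §1 p. 62 and §2 p. 70] [cite: GreenbergVatsal2000, §2 p. 14]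
[cite: SilvermanAEC2009, Prop. VII.2.1 and Cor. III.6.4] -/
theorem natCard_reductionDatum_plus_inf_torsionBy (hpv : ((p : ℕ) : 𝓞 ℚ) ∈ v.asIdeal)
    (hΔ : ¬ (p : ℤ) ∣ minimalDiscriminantInt W) (hord : ¬ (p : ℤ) ∣ W.frobeniusTrace p) :
    Nat.card ↥((reductionDatum W p hpv hΔ).plus ⊓ (↥(W.geomPrimaryTorsion p))[(p : ℤ)]) = p := by
  -- residue characteristic `p` and the ordinary point (as in `GreenbergVatsalStrictAtPQuotient`)
  have hΔu := W.isUnit_Δ_localIntModel hpv (specVal_spec v) hΔ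
  have hvO : (specVal v).Integers (specVal v).valuationSubring :=
    Valuation.valuationSubring.integers (specVal v)
  have hpO : specVal v ((p : ℕ) : AlgebraicClosure (v.adicCompletion ℚ)) < 1 := by
    have h := IsDedekindDomain.HeightOneSpectrum.spectralValuation_algebraMap_ringOfIntegers_lt_one
      (v := v) (specVal_spec v) hpv
    rwa [map_natCast] at h
  haveI hchar : CharP (IsLocalRing.ResidueField ↥(specVal v).valuationSubring) p := by
    refine (CharP.charP_iff_prime_eq_zero hp.out).mpr ?_
    rw [← map_natCast (IsLocalRing.residue ↥(specVal v).valuationSubring),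
      IsLocalRing.residue_eq_zero_iff, IsLocalRing.mem_maximalIdeal, mem_nonunits_iff,
      hvO.isUnit_iff_valuation_eq_one]
    exact fun h ↦ absurd h (ne_of_lt (by simpa using hpO))
  have hordA := W.exists_zsmul_eq_zero_localRed_ne_zero (specVal_spec v) hΔu (localRed W p hpv hΔ)
    (fun _ ↦ rfl) hpv hΔ hord
  obtain ⟨hgenr, -, -⟩ := W.localRed_ordinary_filtration hΔu (localRed W p hpv hΔ) (fun _ ↦ rfl)
    hordA
  obtain ⟨P₁, hP₁red, hP₁ord, hP₁gen⟩ := hgenr 1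
  rw [pow_one] at hP₁ord
  have hpP₁ : p • P₁ = 0 := by rw [← hP₁ord]; exact addOrderOf_nsmul_eq_zero P₁
  -- lift the generator to `E[p^∞](ℚ̄)`
  obtain ⟨m₁, hm₁⟩ := GreenbergVatsalTateDatumCofree.exists_primaryTorsion_pointsMap_eq W p P₁ 1
    (by rw [pow_one]; exact hpP₁)
  have hinj := GreenbergVatsalTateDatumCofree.pointsMap_coe_injective W p (v := v)
  have hm₁C : m₁ ∈ (reductionDatum W p hpv hΔ).plus := by
    rw [mem_reductionDatum_plus_iff, hm₁]; exact hP₁red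
  have hm₁p : m₁ ∈ (↥(W.geomPrimaryTorsion p))[(p : ℤ)] := by
    rw [AddSubgroup.torsionBy, Submodule.mem_toAddSubgroup, Submodule.mem_torsionBy_iff]
    change (p : ℤ) • m₁ = 0
    rw [natCast_zsmul]
    apply hinj
    change pointsMap W (v.adicCompletion ℚ) ((p • m₁ : W.geomPrimaryTorsion p) : W.geomPoints) =
      pointsMap W (v.adicCompletion ℚ) ((0 : W.geomPrimaryTorsion p) : W.geomPoints)
    rw [AddSubmonoidClass.coe_nsmul, map_nsmul, hm₁, hpP₁, ZeroMemClass.coe_zero, map_zero]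
  -- multiples of `m₁` map to multiples of `P₁`
  have hmul : ∀ c : ℕ, pointsMap W (v.adicCompletion ℚ)
      ((c • m₁ : W.geomPrimaryTorsion p) : W.geomPoints) = c • P₁ := fun c ↦ by
    rw [AddSubmonoidClass.coe_nsmul, map_nsmul, hm₁]
  -- the bijection `ℤ/p → C_v ⊓ E[p^∞][p]`
  let f : ZMod p → ↥((reductionDatum W p hpv hΔ).plus ⊓ (↥(W.geomPrimaryTorsion p))[(p : ℤ)]) :=
    fun c ↦ ⟨c.val • m₁, AddSubgroup.mem_inf.2
      ⟨AddSubgroup.nsmul_mem _ hm₁C _, AddSubgroup.nsmul_mem _ hm₁p _⟩⟩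
  have hf : Function.Bijective f := by
    constructor
    · intro c c' h
      have h1 : (c.val • m₁ : W.geomPrimaryTorsion p) = c'.val • m₁ := congrArg Subtype.val h
      have h2 : c.val • P₁ = c'.val • P₁ := by
        rw [← hmul, ← hmul, h1]
      rw [nsmul_inj_mod, hP₁ord, Nat.mod_eq_of_lt (ZMod.val_lt c),
        Nat.mod_eq_of_lt (ZMod.val_lt c')] at h2
      exact ZMod.val_injective p h2
    · rintro ⟨x, hx⟩
      obtain ⟨hxC, hxp⟩ := AddSubgroup.mem_inf.1 hx
      have hpx : (p : ℤ) • x = 0 := by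
        have h := hxp
        rw [AddSubgroup.torsionBy, Submodule.mem_toAddSubgroup, Submodule.mem_torsionBy_iff] at h
        exact h
      have hred : localRed W p hpv hΔ (pointsMap W (v.adicCompletion ℚ) (x : W.geomPoints)) = 0 :=
        (mem_reductionDatum_plus_iff W p hpv hΔ x).1 hxC
      have hpx' : ((p ^ 1 : ℕ) : ℤ) • pointsMap W (v.adicCompletion ℚ) (x : W.geomPoints) = 0 := by
        rw [pow_one, ← map_zsmul, ← AddSubgroupClass.coe_zsmul, hpx, ZeroMemClass.coe_zero, map_zero]
      obtain ⟨c, hc⟩ := hP₁gen _ hred hpx'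
      refine ⟨(c : ZMod p), Subtype.ext ?_⟩
      change ((c : ZMod p).val • m₁ : W.geomPrimaryTorsion p) = x
      apply hinj
      change pointsMap W (v.adicCompletion ℚ)
          ((((c : ZMod p).val • m₁ : W.geomPrimaryTorsion p)) : W.geomPoints) =
        pointsMap W (v.adicCompletion ℚ) (x : W.geomPoints)
      rw [hmul, ZMod.val_natCast, hc]
      -- `(c % p) • P₁ = c • P₁` since `p • P₁ = 0`
      conv_rhs => rw [← Nat.mod_add_div c p]
      rw [add_nsmul, mul_nsmul, hpP₁, nsmul_zero, add_zero]
  rw [← Nat.card_eq_of_bijective f hf, Nat.card_zmod]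

/-- The same for Greenberg's DATA above `p` (`reductionData W p hΔ`): the clause
`∀ v ∋ p, #(C_v ⊓ E[p^∞][p]) = p` in the shape consumed by gen 13's counts (`hC`) and gen 16's
devissage (`hcard`). [cite: GreenbergLNM1716, §1 p. 62 and §2 p. 70] [cite: GreenbergVatsal2000, §2 p. 14] -/
theorem natCard_reductionData_plus_inf_torsionBy (hΔ : ¬ (p : ℤ) ∣ minimalDiscriminantInt W)
    (hord : ¬ (p : ℤ) ∣ W.frobeniusTrace p) :
    ∀ (v : HeightOneSpectrum (𝓞 ℚ)) (hv : ((p : ℕ) : 𝓞 ℚ) ∈ v.asIdeal),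
      Nat.card ↥((reductionData W p hΔ v hv).plus ⊓ (↥(W.geomPrimaryTorsion p))[(p : ℤ)]) = p :=
  fun _ hv ↦ natCard_reductionDatum_plus_inf_torsionBy W p hv hΔ hord

end Summit.BirchSwinnertonDyer.Rank1Residual.X2.GreenbergVatsalReductionDatum

end
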